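import Summits.ValiantsHypothesis.ValiantsHypothesis.Theorems.KPlusLogSqLawTropicalBFourRowFamily
import Summits.ValiantsHypothesis.ValiantsHypothesis.Theorems.KPlusLogSqLawTropicalBThreeRowEightSigned

/-!
# Route «KPlusLogSqLaw», crux `TropicalB` (stmt-ValiantsHypothesis-19771) — the `m = 4` tropical row for ALL `K`, SIGNED:
# `T(4,K) ≥ 12K − 49` (twelve sign changes per class level along the self-similar thirteen-term family `FourRowFamily`)

HONEST FRAMING.  Helper file (cell `pub-symmetroid`, seat val-sym-trop-p3 (g5), 2026-08-27) for the registered stubs of the OPEN crux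
`TropicalB`; a SMALL-FORMAT census row (`m = 4`, every `K`) in the super-fat corner, far off the crux window.  Nothing here bears on
`TropicalB` in its window, `WeakLifting`, the doors, `MatrixDescartes` (stmt-ValiantsHypothesis-18050) or VP ≠ VNP; a FLOOR refutes no law.

WHAT IS PROVED.  On the self-similar family of `…FourRowFamily` (thirteen uniquely dominant terms per class level, rail `5^l`, all `K ≥ 5`),
the periodic sign pattern `ε(a,b,l) = (−1)^(s(a,b) + t(a,b)·l)` (`es`) makes TWELVE of the thirteen phases of every level alternate with
level-independent term signs (`termSign_sub`, `chi`), across the level wrap too; hence `FourRowFamily.alternating` and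

* **`FourRowFamily.not_tropRootLawAt (K') : ¬ TropRootLawAt 4 (K' + 5) (12·K' + 10)`** — **`T(4,K) ≥ 12K − 49` for every `K ≥ 5`**
  (what padding the `(3,K)` families gives: `9K − 37`; unsigned: `FourRowFamily.not_tropRowD`, `13K − 53`; ceilings: thin law `96K`, half-thin `≈ 56K`).

Dominance is transported from the unsigned design along equal supports (`ThreeRowEight.isDominant_of_support`).
[this seat's construction (self-similar template search `sssearchM.py`, generator `gen_familyM.py`); the rows are the cell's definitions; no citation]
-/

set_option linter.dupNamespace false
set_option autoImplicit false

namespace Summit.ValiantsHypothesis.ValiantsHypothesis.Theorems.KPlusLogSqLaw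

open Summit.ValiantsHypothesis.ValiantsHypothesis.Theorems.MatrixDescartes.Negative
open Summit.ValiantsHypothesis.ValiantsHypothesis.Theorems.LacunarySymmetroidMatrixDescartes.TropicalCensus

namespace FourRowFamily

/-! ## Signed sub-chain: 12 of the 13 phases per level alternate in sign (term signs flip with the level parity) -/

/-- sign offsets. -/
def sb : Fin 4 → Fin 4 → ℕ := ![![0, 0, 0, 0], ![0, 1, 0, 0], ![0, 0, 1, 0], ![0, 0, 0, 1]]

/-- class-parity bits. -/
def tb : Fin 4 → Fin 4 → ℕ := ![![0, 1, 1, 0], ![1, 0, 0, 0], ![0, 1, 1, 0], ![0, 0, 1, 1]]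

/-- the signed design `ε = (−1)^(s + t·l)` on present cells. -/
def es (K : ℕ) : Fin 4 → Fin 4 → Fin K → ℤ :=
  fun a b l => if ab a b = true then 0 else (-1) ^ (sb a b + tb a b * (l : ℕ))

/-- the phases used by the signed sub-chain (increasing). -/
def sph : Fin 12 → ℕ := ![0, 1, 2, 4, 5, 6, 7, 8, 9, 10, 11, 12]

/-- term signs of the sub-chain's phases at EVEN levels (they flip at odd levels). -/
def chi : Fin 12 → ℤ := ![(-1 : ℤ), 1, (-1 : ℤ), 1, (-1 : ℤ), 1, (-1 : ℤ), 1, (-1 : ℤ), 1, (-1 : ℤ), 1]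

/-- template permutations as value tables. -/
def sgv : Fin 13 → Fin 4 → Fin 4 := ![![2, 1, 0, 3], ![2, 1, 0, 3], ![0, 1, 2, 3], ![0, 1, 2, 3], ![2, 1, 0, 3], ![0, 2, 1, 3], ![2, 0, 1, 3], ![3, 2, 0, 1], ![1, 2, 0, 3], ![1, 2, 0, 3], ![1, 0, 2, 3], ![2, 0, 3, 1], ![2, 0, 1, 3]]

/-- signs of the template permutations. -/
def sgn : Fin 13 → ℤ := ![(-1 : ℤ), (-1 : ℤ), 1, 1, (-1 : ℤ), (-1 : ℤ), 1, (-1 : ℤ), 1, 1, (-1 : ℤ), (-1 : ℤ), 1]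

/-- `sg` evaluates to `sgv`. -/
theorem sg_apply : ∀ (j : Fin 13) (i : Fin 4), sg j i = sgv j i := by decide

/-- signs of the template permutations. -/
theorem sign_sg : ∀ j : Fin 13, (Equiv.Perm.sign (sg j) : ℤ) = sgn j := by decide

/-- the sub-chain's phases are phases. -/
theorem sph_lt : ∀ i : Fin 12, sph i < 13 := by decide

/-- the sub-chain's phases increase. -/
theorem sph_mono : ∀ i i' : Fin 12, i < i' → sph i < sph i' := by decide

/-- index of the `k`-th sub-chain term in the full chain. -/
def kf (k : ℕ) : ℕ := 13 * (k / 12) + sph ⟨k % 12, Nat.mod_lt _ (by norm_num)⟩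

/-- level of the `k`-th sub-chain term. -/
theorem kf_div (k : ℕ) : kf k / 13 = k / 12 := by
  unfold kf; have := sph_lt ⟨k % 12, Nat.mod_lt _ (by norm_num)⟩; omega

/-- phase of the `k`-th sub-chain term. -/
theorem kf_mod (k : ℕ) : kf k % 13 = sph ⟨k % 12, Nat.mod_lt _ (by norm_num)⟩ := by
  unfold kf; have := sph_lt ⟨k % 12, Nat.mod_lt _ (by norm_num)⟩; omega

/-- the sub-chain runs through the full chain increasingly. -/
theorem kf_lt_succ (k : ℕ) : kf k < kf (k + 1) := by
  unfold kf
  by_cases h : k % 12 < 11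
  · have hmono := sph_mono ⟨k % 12, Nat.mod_lt _ (by norm_num)⟩ ⟨(k + 1) % 12, Nat.mod_lt _ (by norm_num)⟩
      (by simp only [Fin.mk_lt_mk]; omega)
    have : (k + 1) / 12 = k / 12 := by omega
    rw [this]; omega
  · have h1 : (k + 1) / 12 = k / 12 + 1 := by omega
    have h2 := sph_lt ⟨k % 12, Nat.mod_lt _ (by norm_num)⟩
    rw [h1]; omega

/-- equal supports. -/
theorem es_zero_iff (K : ℕ) (a b : Fin 4) (l : Fin K) : ee K a b l = 0 ↔ es K a b l = 0 := by
  simp only [ee, es]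
  by_cases hab : ab a b = true
  · simp [hab]
  · rw [if_neg hab, if_neg hab]
    constructor
    · intro h; norm_num at h
    · intro h
      exact absurd h (pow_ne_zero _ (by norm_num))

/-- signs are in `{0, ±1}`. -/
theorem es_natAbs_le (K : ℕ) (a b : Fin 4) (l : Fin K) : (es K a b l).natAbs ≤ 1 := by
  simp only [es]
  split_ifs
  · simp
  · rcases neg_one_pow_eq_or ℤ (sb a b + tb a b * (l : ℕ)) with h | h <;> simp [h]

/-- the term sign of the `i`-th sub-phase at level `q + 4` is `chi i · (−1)^q`. -/
theorem termSign_sub (K' : ℕ) (i : Fin 12) (q : ℕ) (c : Fin 4 → Fin (K' + 5))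
    (hc : ∀ b, ((c b : Fin (K' + 5)) : ℕ) = q + co ⟨sph i, sph_lt i⟩ b) :
    termSign (es (K' + 5)) (sg ⟨sph i, sph_lt i⟩, c) = chi i * (-1) ^ (0 * q) := by
  unfold termSign
  rw [Fin.prod_univ_four]
  simp only [sign_sg, sg_apply, es, hc]
  fin_cases i <;>
    simp [sph, sgv, sgn, sb, tb, co, chi, ab, pow_add] <;>
    (rcases neg_one_pow_eq_or ℤ q with h | h <;> try simp [h])

/-- consecutive sub-chain signs alternate (inside a level, and across the level wrap where both factors flip). -/
theorem chi_alt_in : ∀ i : Fin 12, (i : ℕ) < 11 → chi i * chi (i + 1) < 0 := by decide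

/-- across the level wrap the two signs agree (the level parity flips one of them). -/
theorem chi_wrap : chi 11 * chi 0 < 0 := by decide

/-- **The signed chain**: `12(K'+1)` alternating uniquely dominant terms, format `(4, K'+5)`. -/
theorem alternating (K' : ℕ) :
    ∃ (d : Fin (K' + 5) → ℕ) (v ε : Fin 4 → Fin 4 → Fin (K' + 5) → ℤ), (∀ i j l, (ε i j l).natAbs ≤ 1) ∧
      ∃ (θ : Fin (12 * K' + 11 + 1) → ℤ) (p : Fin (12 * K' + 11 + 1) → Equiv.Perm (Fin 4) × (Fin 4 → Fin (K' + 5))),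
        StrictMono θ ∧ (∀ k, IsDominant d v ε (θ k) (p k)) ∧
        ∀ k : Fin (12 * K' + 11), termSign ε (p k.castSucc) * termSign ε (p k.succ) < 0 := by
  have hkK : ∀ k : Fin (12 * K' + 11 + 1), kf (k : ℕ) / 13 ≤ K' := fun k => by rw [kf_div]; have := k.isLt; omega
  refine ⟨dd (K' + 5), vv (K' + 5), es (K' + 5), es_natAbs_le (K' + 5), fun k => th (kf k), fun k => (sg (ph (kf k)), cl K' (kf k) (hkK k)),
    ?_, ?_, ?_⟩
  · -- strict monotonicity of the slopes along the sub-chain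
    refine Fin.strictMono_iff_lt_succ.mpr ?_
    intro k
    simp only [th, Fin.val_castSucc, Fin.val_succ]
    have := kf_lt_succ (k : ℕ)
    omega
  · intro k
    exact ThreeRowEight.isDominant_of_support _ _ _ _ (es_zero_iff (K' + 5)) _ _ (dominant K' (kf k) (hkK k))
  · intro k
    -- rewrite both term signs through `termSign_sub`
    have hph : ∀ k' : ℕ, ph (kf k') = ⟨sph ⟨k' % 12, Nat.mod_lt _ (by norm_num)⟩, sph_lt _⟩ := by
      intro k'; apply Fin.ext; simp only [ph]; exact kf_mod k'
    have hcl : ∀ (k' : ℕ) (hk : kf k' / 13 ≤ K') (b : Fin 4),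
        ((cl K' (kf k') hk b : Fin (K' + 5)) : ℕ) = k' / 12 + co ⟨sph ⟨k' % 12, Nat.mod_lt _ (by norm_num)⟩, sph_lt _⟩ b := by
      intro k' hk b
      show kf k' / 13 + co (ph (kf k')) b = _
      rw [kf_div, hph]
    have h1 := termSign_sub K' ⟨(k : ℕ) % 12, Nat.mod_lt _ (by norm_num)⟩ ((k : ℕ) / 12) (cl K' (kf k) (hkK k.castSucc))
      (hcl k (hkK k.castSucc))
    have h2 := termSign_sub K' ⟨((k : ℕ) + 1) % 12, Nat.mod_lt _ (by norm_num)⟩ (((k : ℕ) + 1) / 12) (cl K' (kf (k + 1)) (hkK k.succ))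
      (hcl (k + 1) (hkK k.succ))
    simp only [Fin.val_castSucc, Fin.val_succ]
    rw [← hph k] at h1
    rw [← hph (k + 1)] at h2
    rw [h1, h2]
    by_cases h : (k : ℕ) % 12 < 11
    · -- inside a level: same `q`, consecutive sub-phases
      have hq : ((k : ℕ) + 1) / 12 = (k : ℕ) / 12 := by omega
      have hi : (⟨((k : ℕ) + 1) % 12, Nat.mod_lt _ (by norm_num)⟩ : Fin 12) = ⟨(k : ℕ) % 12, Nat.mod_lt _ (by norm_num)⟩ + 1 := by
        apply Fin.ext; simp only [Fin.val_add]; omega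
      rw [hq, hi]
      have hc := chi_alt_in ⟨(k : ℕ) % 12, Nat.mod_lt _ (by norm_num)⟩ (by simpa using h)
      have hsq : ((-1 : ℤ) ^ (0 * ((k : ℕ) / 12))) * ((-1 : ℤ) ^ (0 * ((k : ℕ) / 12))) = 1 := by
        rw [← pow_add, ← two_mul, pow_mul]; simp
      nlinarith [hc, hsq]
    · -- wrap to the next level: `q ↦ q + 1` flips one factor
      have hq : ((k : ℕ) + 1) / 12 = (k : ℕ) / 12 + 1 := by omega
      have hi0 : (⟨((k : ℕ) + 1) % 12, Nat.mod_lt _ (by norm_num)⟩ : Fin 12) = 0 := by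
        apply Fin.ext; simp; omega
      have hi7 : (⟨(k : ℕ) % 12, Nat.mod_lt _ (by norm_num)⟩ : Fin 12) = 11 := by
        apply Fin.ext; simp; omega
      rw [hq, hi0, hi7]
      have hc := chi_wrap
      have hsq : ((-1 : ℤ) ^ (0 * ((k : ℕ) / 12))) * ((-1 : ℤ) ^ (0 * ((k : ℕ) / 12))) = 1 := by
        rw [← pow_add, ← two_mul, pow_mul]; simp
      have hstep : ((-1 : ℤ) ^ (0 * ((k : ℕ) / 12 + 1))) = (-1) ^ 0 * (-1 : ℤ) ^ (0 * ((k : ℕ) / 12)) := by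
        rw [mul_add, mul_one, pow_add, mul_comm]
      rw [hstep]
      norm_num
      nlinarith [hc, hsq]

end FourRowFamily

/-- **Signed `(4,K)` row floor, all `K ≥ 5`:** `¬ TropRootLawAt 3 (K'+5) (12K'+10)`, i.e. `T(4,K) ≥ 12K − 49`. -/
theorem FourRowFamily.not_tropRootLawAt (K' : ℕ) : ¬ TropRootLawAt 4 (K' + 5) (12 * K' + 10) := by
  intro h
  obtain ⟨d, v, ε, hε, θ, p, hθ, hdom, halt⟩ := FourRowFamily.alternating K'
  have := h d v ε (12 * K' + 11) θ p hε hθ hdom halt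
  omega

end Summit.ValiantsHypothesis.ValiantsHypothesis.Theorems.KPlusLogSqLaw
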